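import Mathlib
import HarnessLib
import Summits.ResolutionOfSingularities.ResolutionOfSingularities.Theorems.WildQuotientsWildQuotientResolutionS1aKillCert
import Summits.ResolutionOfSingularities.ResolutionOfSingularities.Theorems.WildQuotientsWildQuotientResolutionS1aReesKill

/-!
# S1a — THE INITIAL-FORM KILL CRITERION (KC3) and the smooth transversal (2,1)-type (KC4)

[OURS · L1 W4.5c · lead-1 g10; plan-1 g13 KILL-CRITERION v1 §3 / SIG KC v1 made theorems] — NOT statements of the manuscript; counted 0;
AI-level work, weaker than expert review. Crux stmt-ResolutionOfSingularities-17941 `CyclicQuotientFourfolds`, line `s1a-logminvertex` v10, K-side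
(`stub_killTouchReachAux`). Route-independent; pure algebra on the cobordant algebra `R^w = B[s, fᵢ t^{wᵢ}]`.

KILL(C, w) ⟸ ADMISSIBLE(w, δ = 1) ∧ IN_w(θ) IRRELEVANT on E ∧ C = Bad ∩ O:
* `algebraMap_eq_s_pow_mul` — `y = s^m · (y t^m)` in `R^w` for `y ∈ 𝒥_m`; `sigmaR_sub_eq_of_admissible` — for `y ∈ 𝒥ₙ` with `σ y − y = β j`,
  `j ∈ 𝒥ₙ₊₁`: `σ_R (y tⁿ) − y tⁿ = β s · (j tⁿ⁺¹)`;
* ★★ **KC3** `cobordantKillCert_of_admissible_of_irrelevant` — `(a′)` boundary-admissibility with δ = 1 (`y ∈ 𝒥ₙ ⇒ σ y − y ∈ β 𝒥ₙ₊₁`) ∧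
  `(ii)` isolation (`(f)^N ≤ (augIdeal σ : β)`) ∧ `(i)` irrelevance of the shifted initial forms (`vertexIdeal^N ≤ (augIdeal σ_R : β s) ⊔ (s)`)
  ⇒ `CobordantKillCert … (β s)`. NO Noetherian and NO non-zero-divisor hypothesis is needed (the vertex ideal is finitely generated; (H1) is (a′)
  on the generators `B ∪ {s} ∪ {fᵢ t^{wᵢ}}`; (H2): every prime over `𝔞 = (augIdeal σ_R : βs)` contains the vertex ideal — if `s ∈ P` by (i), if
  `s ∉ P` because `J · R^w ≤ 𝔞` and (ii) give `fᵢ = s^{wᵢ} fᵢʼ ∈ P`);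
* ★ **KC4** `irrelevant_of_smoothTransversalType` — the census' kill leaf, all `p`, `N = 1`: centre `(x₁, x₃)` with weights `(2, 1)`, units `h, u`,
  `σ x₃ − x₃ − β h x₁ ∈ β 𝒥₃`, `σ x₄ − x₄ − β u x₃ ∈ β 𝒥₂` ⇒ hypothesis (i) of KC3 with `N = 1`;
* `cobordantKillCert_smoothTransversalType` — KC3 ∘ KC4: (a′) ∧ (ii) ∧ the two congruences ⇒ the certificate `β s`.
-/

set_option linter.dupNamespace false

noncomputable section

open Literature.AlgebraicGeometry.Resolution
open scoped LaurentPolynomial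
open LaurentPolynomial
open Summit.ResolutionOfSingularities.ResolutionOfSingularities.Theorems.WildQuotientResolution.S1.CoarseChart

namespace Summit.ResolutionOfSingularities.ResolutionOfSingularities.Theorems.WildQuotientResolution.S1.KillCert

universe u

section KC

variable {B : Type u} [CommRing B] {c : ℕ} (f : Fin c → B) (w : Fin c → ℕ) (σ : B ≃+* B)
  (hσJ : ∀ n : ℕ, ((weightedFiltration f w).ideal n).map (σ : B →+* B) ≤ (weightedFiltration f w).ideal n)
  {p : ℕ} (hp : 0 < p) (hσp : ∀ x : B, (⇑σ)^[p] x = x)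

/-! ## Monomials `y tᵐ` and the twisted derivation -/

/-- **`y = s^m · (y t^m)` in `R^w`** for `y ∈ 𝒥_m` and any `z ∈ R^w` with underlying Laurent polynomial `y T^m`. [OURS · L1 W4.5c] -/
theorem algebraMap_eq_s_pow_mul {m : ℕ} {y : B} (z : ↥(cobordantAlgebra f w)) (hz : (z : B[T;T⁻¹]) = C y * T (m : ℤ)) :
    algebraMap B (↥(cobordantAlgebra f w)) y = cobordantAlgebra.s f w ^ m * z := by
  apply Subtype.ext
  rw [cobordantAlgebra.coe_algebraMap, MulMemClass.coe_mul, cobordantAlgebra.coe_s_pow, hz, mul_left_comm, ← mul_assoc,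
    mul_T_assoc, neg_add_cancel, T_zero, mul_one]

/-- Powers of `s` are non-zero-divisors of `R^w`. -/
theorem s_pow_mem_nonZeroDivisors (m : ℕ) : cobordantAlgebra.s f w ^ m ∈ nonZeroDivisors (↥(cobordantAlgebra f w)) :=
  Submonoid.pow_mem _ (cobordantAlgebra.s_mem_nonZeroDivisors f w) m

/-- `σ_R` fixes the powers of `s`. -/
theorem sigmaR_s_pow (m : ℕ) : sigmaR σ f w hσJ hp hσp (cobordantAlgebra.s f w ^ m) = cobordantAlgebra.s f w ^ m := by
  rw [map_pow, sigmaR_s]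

/-- **The twisted derivation on monomials.** If `y ∈ 𝒥ₙ` and `σ y − y = β · j` with `j ∈ 𝒥ₙ₊₁` (boundary-admissibility with `δ = 1` at `y`), then
in `R^w`: `σ_R (y tⁿ) − y tⁿ = (β s) · (j tⁿ⁺¹)` (for any `z, z'` with underlying Laurent polynomials `y Tⁿ`, `j Tⁿ⁺¹`). Proof: multiply by the
non-zero-divisor `sⁿ` and compute in `B`. [OURS · L1 W4.5c] -/
theorem sigmaR_sub_eq_of_admissible (β : B) {n : ℕ} {y j : B} (hyj : σ y - y = β * j) (z z' : ↥(cobordantAlgebra f w))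
    (hz : (z : B[T;T⁻¹]) = C y * T (n : ℤ)) (hz' : (z' : B[T;T⁻¹]) = C j * T ((n + 1 : ℕ) : ℤ)) :
    sigmaR σ f w hσJ hp hσp z - z = (algebraMap B (↥(cobordantAlgebra f w)) β * cobordantAlgebra.s f w) * z' := by
  rw [← mul_cancel_right_mem_nonZeroDivisors (s_pow_mem_nonZeroDivisors f w n)]
  have h1 : z * cobordantAlgebra.s f w ^ n = algebraMap B (↥(cobordantAlgebra f w)) y := by
    rw [algebraMap_eq_s_pow_mul f w z hz, mul_comm]
  have h2 : z' * cobordantAlgebra.s f w ^ (n + 1) = algebraMap B (↥(cobordantAlgebra f w)) j := by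
    rw [algebraMap_eq_s_pow_mul f w z' hz', mul_comm]
  have h3 : sigmaR σ f w hσJ hp hσp z * cobordantAlgebra.s f w ^ n = algebraMap B (↥(cobordantAlgebra f w)) (σ y) := by
    rw [← sigmaR_algebraMap σ f w hσJ hp hσp, ← h1, map_mul, sigmaR_s_pow]
  have h4 : algebraMap B (↥(cobordantAlgebra f w)) (σ y) - algebraMap B (↥(cobordantAlgebra f w)) y =
      algebraMap B (↥(cobordantAlgebra f w)) β * algebraMap B (↥(cobordantAlgebra f w)) j := by
    rw [← map_sub, hyj, map_mul]
  calc (sigmaR σ f w hσJ hp hσp z - z) * cobordantAlgebra.s f w ^ n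
      = algebraMap B (↥(cobordantAlgebra f w)) (σ y) - algebraMap B (↥(cobordantAlgebra f w)) y := by rw [sub_mul, h3, h1]
    _ = algebraMap B (↥(cobordantAlgebra f w)) β * (z' * cobordantAlgebra.s f w ^ (n + 1)) := by rw [h4, h2]
    _ = algebraMap B (↥(cobordantAlgebra f w)) β * cobordantAlgebra.s f w * z' * cobordantAlgebra.s f w ^ n := by ring

/-- `𝒥₀ = B`. -/
theorem mem_weightedFiltration_zero (y : B) : y ∈ (weightedFiltration f w).ideal 0 := by
  rw [(weightedFiltration f w).ideal_zero]
  trivial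

/-! ## KC3: the initial-form kill criterion -/

/-- **(H1) from boundary-admissibility.** If `y ∈ 𝒥ₙ ⇒ σ y − y ∈ β · 𝒥ₙ₊₁` for all `n, y`, then every increment `σ_R z − z`, `z ∈ R^w`, is a
multiple of `β s`: `R^w` is generated by `B ∪ {s} ∪ {fᵢ t^{wᵢ}}`, the elements moved within an ideal form a subring (`ReesKill.movedWithin`), and
on the generators this is `sigmaR_sub_eq_of_admissible` (`σ_R s = s`). [OURS · L1 W4.5c · KILL-CRITERION v1 §3 (H1)] -/
theorem augmentationIdeal_sigmaR_le_span_of_admissible (β : B)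
    (hadm : ∀ (n : ℕ) (y : B), y ∈ (weightedFiltration f w).ideal n →
      σ y - y ∈ Ideal.span {β} * (weightedFiltration f w).ideal (n + 1)) :
    augmentationIdeal (sigmaR σ f w hσJ hp hσp) ≤
      Ideal.span {algebraMap B (↥(cobordantAlgebra f w)) β * cobordantAlgebra.s f w} := by
  rw [augmentationIdeal, Ideal.span_le]
  rintro _ ⟨z, rfl⟩
  change z ∈ ReesKill.movedWithin (sigmaR σ f w hσJ hp hσp)
    (Ideal.span {algebraMap B (↥(cobordantAlgebra f w)) β * cobordantAlgebra.s f w})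
  -- a monomial `y tⁿ`, `y ∈ 𝒥ₙ`, is moved within `(β s)`
  have hmon : ∀ (n : ℕ) (y : B) (hy : y ∈ (weightedFiltration f w).ideal n) (x : ↥(cobordantAlgebra f w)),
      (x : B[T;T⁻¹]) = C y * T (n : ℤ) →
      x ∈ ReesKill.movedWithin (sigmaR σ f w hσJ hp hσp)
        (Ideal.span {algebraMap B (↥(cobordantAlgebra f w)) β * cobordantAlgebra.s f w}) := by
    intro n y hy x hx
    obtain ⟨j, hj, hyj⟩ := Ideal.mem_span_singleton_mul.mp (hadm n y hy)
    rw [ReesKill.mem_movedWithin_iff,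
      sigmaR_sub_eq_of_admissible f w σ hσJ hp hσp β hyj.symm x ⟨_, C_mul_T_mem_cobordantAlgebra f w hj⟩ hx rfl]
    exact Ideal.mul_mem_right _ _ (Ideal.mem_span_singleton_self _)
  induction z using cobordantAlgebra.induction_on with
  | algebraMap a =>
    exact hmon 0 a (mem_weightedFiltration_zero f w a) _ (by rw [cobordantAlgebra.coe_algebraMap, Nat.cast_zero, T_zero, mul_one])
  | s =>
    rw [ReesKill.mem_movedWithin_iff, sigmaR_s, sub_self]
    exact Ideal.zero_mem _
  | u' i => exact hmon (w i) (f i) (mem_weightedFiltration_ideal f w i) _ (cobordantAlgebra.coe_u' f w i)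
  | add x y hx hy => exact add_mem hx hy
  | mul x y hx hy => exact mul_mem hx hy

/-- The residual ideal downstairs extends into the colon ideal upstairs: `j β ∈ augIdeal σ ⇒ j · (β s) ∈ augIdeal σ_R`. [OURS · L1 W4.5c] -/
theorem map_colon_le_colon (β : B) :
    ((augmentationIdeal σ).colon (Ideal.span {β})).map (algebraMap B (↥(cobordantAlgebra f w))) ≤
      (augmentationIdeal (sigmaR σ f w hσJ hp hσp)).colon
        (Ideal.span {algebraMap B (↥(cobordantAlgebra f w)) β * cobordantAlgebra.s f w}) := by
  rw [Ideal.map_le_iff_le_comap]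
  intro j hj
  rw [Ideal.mem_comap, Ideal.mem_colon_span_singleton, ← mul_assoc, ← map_mul]
  refine Ideal.mul_mem_right _ _ ?_
  exact OneShotKill.map_augmentationIdeal_le σ (sigmaR σ f w hσJ hp hσp) (sigmaR_algebraMap σ f w hσJ hp hσp)
    (Ideal.mem_map_of_mem _ (Ideal.mem_colon_span_singleton.mp hj))

/-- **(H2) from irrelevance and isolation**: every prime `P ⊇ 𝔞 = (augIdeal σ_R : βs)` contains the vertex ideal, hence (finite generation)
`vertexIdeal^N ≤ 𝔞` for some `N`. [OURS · L1 W4.5c · KILL-CRITERION v1 §3 (H2)] -/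
theorem exists_vertexIdeal_pow_le_colon (β : B)
    (hiso : ∃ N : ℕ, Ideal.span (Set.range f) ^ N ≤ (augmentationIdeal σ).colon (Ideal.span {β}))
    (hirr : ∃ N : ℕ, cobordantAlgebra.vertexIdeal f w ^ N ≤
      (augmentationIdeal (sigmaR σ f w hσJ hp hσp)).colon
          (Ideal.span {algebraMap B (↥(cobordantAlgebra f w)) β * cobordantAlgebra.s f w}) ⊔
        cobordantAlgebra.excIdeal f w) :
    ∃ N : ℕ, cobordantAlgebra.vertexIdeal f w ^ N ≤
      (augmentationIdeal (sigmaR σ f w hσJ hp hσp)).colon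
        (Ideal.span {algebraMap B (↥(cobordantAlgebra f w)) β * cobordantAlgebra.s f w}) := by
  obtain ⟨N₁, hN₁⟩ := hiso
  obtain ⟨N₂, hN₂⟩ := hirr
  refine Ideal.exists_pow_le_of_le_radical_of_fg ?_ (Submodule.fg_span (Set.finite_range _))
  rw [Ideal.radical_eq_sInf, le_sInf_iff]
  rintro P ⟨haP, hP⟩
  rw [cobordantAlgebra.vertexIdeal, Ideal.span_le]
  rintro _ ⟨i, rfl⟩
  by_cases hs : cobordantAlgebra.s f w ∈ P
  · -- on the exceptional divisor: `P ⊇ 𝔞 ⊔ (s) ⊇ vertexIdeal ^ N₂`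
    have hle : cobordantAlgebra.vertexIdeal f w ^ N₂ ≤ P := by
      refine hN₂.trans (sup_le haP ?_)
      rw [cobordantAlgebra.excIdeal, Ideal.span_singleton_le_iff_mem]
      exact hs
    exact hP.mem_of_pow_mem N₂ (hle (Ideal.pow_mem_pow (cobordantAlgebra.u'_mem_vertexIdeal f w i) N₂))
  · -- off the exceptional divisor: `J · R^w ≤ 𝔞 ≤ P`, `fᵢ ∈ √J`, `fᵢ = s^{wᵢ} fᵢʼ`, `s ∉ P`
    have hfi : algebraMap B (↥(cobordantAlgebra f w)) (f i) ∈ P := by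
      refine hP.mem_of_pow_mem N₁ ?_
      rw [← map_pow]
      refine haP (map_colon_le_colon f w σ hσJ hp hσp β (Ideal.mem_map_of_mem _ (hN₁ ?_)))
      exact Ideal.pow_mem_pow (Ideal.subset_span (Set.mem_range_self i)) N₁
    rw [cobordantAlgebra.algebraMap_u] at hfi
    exact (hP.mem_or_mem hfi).resolve_left fun h => hs (hP.mem_of_pow_mem _ h)

/-- ★★ **KC3 — THE INITIAL-FORM KILL CRITERION.** Let `β ∈ B` (the boundary monomial). Assume
(a′) BOUNDARY-ADMISSIBILITY with `δ = 1`: `y ∈ 𝒥ₙ ⇒ σ y − y ∈ β · 𝒥ₙ₊₁` (the twisted derivation `θ = (σ − 1)/β` raises the `w`-order);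
(ii) ISOLATION: `(f)^N ≤ J := (augIdeal σ : β)` (on this chart the centre is the whole residual bad locus);
(i) IRRELEVANCE OF THE SHIFTED INITIAL FORMS: `vertexIdeal^N ≤ (augIdeal σ_R : β s) ⊔ (s)` (on the exceptional divisor `s = 0` the quotients of the
increments by `β s` have no common zero off the vertex).
Then `β s` is a cobordant kill certificate — so (KC1) the augmentation ideal of `σʼ` is `(β s)` on every σ-fixed chart. No Noetherian / non-zero-divisor
hypothesis. [OURS · L1 W4.5c · KILL-CRITERION v1 KC3; NOT a statement of the manuscript] -/
theorem cobordantKillCert_of_admissible_of_irrelevant (β : B)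
    (hadm : ∀ (n : ℕ) (y : B), y ∈ (weightedFiltration f w).ideal n →
      σ y - y ∈ Ideal.span {β} * (weightedFiltration f w).ideal (n + 1))
    (hiso : ∃ N : ℕ, Ideal.span (Set.range f) ^ N ≤ (augmentationIdeal σ).colon (Ideal.span {β}))
    (hirr : ∃ N : ℕ, cobordantAlgebra.vertexIdeal f w ^ N ≤
      (augmentationIdeal (sigmaR σ f w hσJ hp hσp)).colon
          (Ideal.span {algebraMap B (↥(cobordantAlgebra f w)) β * cobordantAlgebra.s f w}) ⊔
        cobordantAlgebra.excIdeal f w) :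
    CobordantKillCert f w σ hσJ hp hσp (algebraMap B (↥(cobordantAlgebra f w)) β * cobordantAlgebra.s f w) := by
  refine ⟨augmentationIdeal_sigmaR_le_span_of_admissible f w σ hσJ hp hσp β hadm, ?_⟩
  obtain ⟨N, hN⟩ := exists_vertexIdeal_pow_le_colon f w σ hσJ hp hσp β hiso hirr
  refine ⟨N, (Ideal.mul_mono_right hN).trans ?_⟩
  rw [Ideal.mul_le]
  intro r hr a ha
  obtain ⟨r', rfl⟩ := Ideal.mem_span_singleton'.mp hr
  rw [mul_assoc, mul_comm _ a]
  exact Ideal.mul_mem_left _ _ (Ideal.mem_colon_span_singleton.mp ha)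

/-! ## KC4: the smooth transversal (2,1)-type -/

/-- From `x · (β s) ∈ augIdeal σ_R` (witnessed as an increment) and `v` a unit: `v x + s z ∈ 𝔞 ⇒ x ∈ 𝔞 ⊔ (s)`. -/
theorem mem_colon_sup_excIdeal_of_unit {I : Ideal (↥(cobordantAlgebra f w))} {g : ↥(cobordantAlgebra f w)}
    {v x z : ↥(cobordantAlgebra f w)} (hv : IsUnit v) (hmem : (v * x + cobordantAlgebra.s f w * z) * g ∈ I) :
    x ∈ I.colon (Ideal.span {g}) ⊔ cobordantAlgebra.excIdeal f w := by
  have h1 : v * x + cobordantAlgebra.s f w * z ∈ I.colon (Ideal.span {g}) ⊔ cobordantAlgebra.excIdeal f w :=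
    Ideal.mem_sup_left (Ideal.mem_colon_span_singleton.mpr hmem)
  have h2 : cobordantAlgebra.s f w * z ∈ I.colon (Ideal.span {g}) ⊔ cobordantAlgebra.excIdeal f w :=
    Ideal.mem_sup_right (Ideal.mul_mem_right _ _ (Ideal.mem_span_singleton_self _))
  have h3 : v * x ∈ I.colon (Ideal.span {g}) ⊔ cobordantAlgebra.excIdeal f w := by
    have := Ideal.sub_mem _ h1 h2
    rwa [add_sub_cancel_right] at this
  obtain ⟨v, rfl⟩ := hv
  exact (Ideal.unit_mul_mem_iff_mem _ v.isUnit).mp h3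

/-- ★ **KC4 — the smooth transversal (2,1)-type** (the census' kill leaf, all `p`): centre `f = (x₁, x₃)` with weights `(2, 1)`, any further element
`x₄`, units `h u : B`, and the two initial-form data `σ x₃ − x₃ − β h x₁ ∈ β 𝒥₃`, `σ x₄ − x₄ − β u x₃ ∈ β 𝒥₂` (in words: `in₂ θ(x₃) = h̄·x̄₁ʼ`,
`in₁ θ(x₄) = ū·x̄₃ʼ`). Then hypothesis (i) of KC3 holds with `N = 1`: in `R^w`, `σ_R x₃ʼ − x₃ʼ = β s (h x₁ʼ + s · j₃t³)` and
`σ_R x₄ − x₄ = β s (u x₃ʼ + s · j₂t²)`, so `h x₁ʼ + s(…)`, `u x₃ʼ + s(…)` lie in the colon ideal and `x₁ʼ, x₃ʼ ∈ 𝔞 ⊔ (s)`.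
[OURS · L1 W4.5c · KILL-CRITERION v1 KC4; NOT a statement of the manuscript] -/
theorem irrelevant_of_smoothTransversalType (f : Fin 2 → B) (β x₄ h u : B) (hh : IsUnit h) (hu : IsUnit u)
    (hσJ : ∀ n : ℕ, ((weightedFiltration f ![2, 1]).ideal n).map (σ : B →+* B) ≤ (weightedFiltration f ![2, 1]).ideal n)
    (h₃ : σ (f 1) - f 1 - β * h * f 0 ∈ Ideal.span {β} * (weightedFiltration f ![2, 1]).ideal 3)
    (h₄ : σ x₄ - x₄ - β * u * f 1 ∈ Ideal.span {β} * (weightedFiltration f ![2, 1]).ideal 2) :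
    cobordantAlgebra.vertexIdeal f ![2, 1] ≤
      (augmentationIdeal (sigmaR σ f ![2, 1] hσJ hp hσp)).colon
          (Ideal.span {algebraMap B (↥(cobordantAlgebra f ![2, 1])) β * cobordantAlgebra.s f ![2, 1]}) ⊔
        cobordantAlgebra.excIdeal f ![2, 1] := by
  -- names
  obtain ⟨R, hR⟩ : ∃ R : Subalgebra B B[T;T⁻¹], R = cobordantAlgebra f ![2, 1] := ⟨_, rfl⟩
  subst hR
  obtain ⟨j₃, hj₃, e₃⟩ := Ideal.mem_span_singleton_mul.mp h₃
  obtain ⟨j₂, hj₂, e₂⟩ := Ideal.mem_span_singleton_mul.mp h₄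
  have hw0 : (![2, 1] : Fin 2 → ℕ) 0 = 2 := rfl
  have hw1 : (![2, 1] : Fin 2 → ℕ) 1 = 1 := rfl
  -- the players in `R^w`
  have es := cobordantAlgebra.s_mem_nonZeroDivisors f ![2, 1]
  have hx₁ : algebraMap B (↥(cobordantAlgebra f ![2, 1])) (f 0) =
      cobordantAlgebra.s f ![2, 1] ^ 2 * cobordantAlgebra.u' f ![2, 1] 0 := by
    rw [cobordantAlgebra.algebraMap_u, hw0]
  have hx₃ : algebraMap B (↥(cobordantAlgebra f ![2, 1])) (f 1) =
      cobordantAlgebra.s f ![2, 1] ^ 1 * cobordantAlgebra.u' f ![2, 1] 1 := by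
    rw [cobordantAlgebra.algebraMap_u, hw1]
  have hz₃ : algebraMap B (↥(cobordantAlgebra f ![2, 1])) j₃ =
      cobordantAlgebra.s f ![2, 1] ^ 3 * ⟨_, C_mul_T_mem_cobordantAlgebra f ![2, 1] hj₃⟩ :=
    algebraMap_eq_s_pow_mul f ![2, 1] _ rfl
  have hz₂ : algebraMap B (↥(cobordantAlgebra f ![2, 1])) j₂ =
      cobordantAlgebra.s f ![2, 1] ^ 2 * ⟨_, C_mul_T_mem_cobordantAlgebra f ![2, 1] hj₂⟩ :=
    algebraMap_eq_s_pow_mul f ![2, 1] _ rfl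
  have hσx₃ : sigmaR σ f ![2, 1] hσJ hp hσp (cobordantAlgebra.u' f ![2, 1] 1) * cobordantAlgebra.s f ![2, 1] =
      algebraMap B (↥(cobordantAlgebra f ![2, 1])) (σ (f 1)) := by
    rw [← sigmaR_algebraMap σ f ![2, 1] hσJ hp hσp, hx₃, pow_one, map_mul, sigmaR_s, mul_comm]
  have h0 : cobordantAlgebra.u' f ![2, 1] 0 ∈
      (augmentationIdeal (sigmaR σ f ![2, 1] hσJ hp hσp)).colon
          (Ideal.span {algebraMap B (↥(cobordantAlgebra f ![2, 1])) β * cobordantAlgebra.s f ![2, 1]}) ⊔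
        cobordantAlgebra.excIdeal f ![2, 1] := by
    -- `x₁ʼ`: from the increment of `x₃ʼ`
    refine mem_colon_sup_excIdeal_of_unit f ![2, 1] (hh.map (algebraMap B (↥(cobordantAlgebra f ![2, 1]))))
      (z := ⟨_, C_mul_T_mem_cobordantAlgebra f ![2, 1] hj₃⟩) ?_
    have key : (algebraMap B (↥(cobordantAlgebra f ![2, 1])) h * cobordantAlgebra.u' f ![2, 1] 0 +
          cobordantAlgebra.s f ![2, 1] * ⟨_, C_mul_T_mem_cobordantAlgebra f ![2, 1] hj₃⟩) *
        (algebraMap B (↥(cobordantAlgebra f ![2, 1])) β * cobordantAlgebra.s f ![2, 1]) =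
        sigmaR σ f ![2, 1] hσJ hp hσp (cobordantAlgebra.u' f ![2, 1] 1) - cobordantAlgebra.u' f ![2, 1] 1 := by
      rw [← mul_cancel_right_mem_nonZeroDivisors es, sub_mul, hσx₃]
      have e : algebraMap B (↥(cobordantAlgebra f ![2, 1])) (σ (f 1)) =
          algebraMap B (↥(cobordantAlgebra f ![2, 1])) (f 1) +
            algebraMap B (↥(cobordantAlgebra f ![2, 1])) β * algebraMap B (↥(cobordantAlgebra f ![2, 1])) h *
              algebraMap B (↥(cobordantAlgebra f ![2, 1])) (f 0) +
            algebraMap B (↥(cobordantAlgebra f ![2, 1])) β * algebraMap B (↥(cobordantAlgebra f ![2, 1])) j₃ := by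
        rw [← map_mul, ← map_mul, ← map_mul, ← map_add, ← map_add, e₃]
        congr 1
        ring
      rw [e, hx₁, hx₃, hz₃]
      ring
    rw [key]
    exact sub_mem_augmentationIdeal _ _
  have h1 : cobordantAlgebra.u' f ![2, 1] 1 ∈
      (augmentationIdeal (sigmaR σ f ![2, 1] hσJ hp hσp)).colon
          (Ideal.span {algebraMap B (↥(cobordantAlgebra f ![2, 1])) β * cobordantAlgebra.s f ![2, 1]}) ⊔
        cobordantAlgebra.excIdeal f ![2, 1] := by
    -- `x₃ʼ`: from the increment of `x₄`
    refine mem_colon_sup_excIdeal_of_unit f ![2, 1] (hu.map (algebraMap B (↥(cobordantAlgebra f ![2, 1]))))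
      (z := ⟨_, C_mul_T_mem_cobordantAlgebra f ![2, 1] hj₂⟩) ?_
    have key : (algebraMap B (↥(cobordantAlgebra f ![2, 1])) u * cobordantAlgebra.u' f ![2, 1] 1 +
          cobordantAlgebra.s f ![2, 1] * ⟨_, C_mul_T_mem_cobordantAlgebra f ![2, 1] hj₂⟩) *
        (algebraMap B (↥(cobordantAlgebra f ![2, 1])) β * cobordantAlgebra.s f ![2, 1]) =
        sigmaR σ f ![2, 1] hσJ hp hσp (algebraMap B (↥(cobordantAlgebra f ![2, 1])) x₄) -
          algebraMap B (↥(cobordantAlgebra f ![2, 1])) x₄ := by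
      rw [sigmaR_algebraMap, ← map_sub]
      have e : σ x₄ - x₄ = β * u * f 1 + β * j₂ := by rw [e₂]; ring
      rw [e, map_add, map_mul, map_mul, map_mul, hx₃, hz₂]
      ring
    rw [key]
    exact sub_mem_augmentationIdeal _ _
  rw [cobordantAlgebra.vertexIdeal, Ideal.span_le]
  rintro _ ⟨i, rfl⟩
  fin_cases i
  exacts [h0, h1]

/-- **KC3 ∘ KC4: the (2,1)-type kills.** Boundary-admissibility (a′), isolation (ii) and the two congruences of the smooth transversal (2,1)-type give the
cobordant kill certificate `β s` — hence (KC1) a principal augmentation ideal `(β s)` on every σ-fixed chart of the weighted blow-up of `(x₁, x₃)` with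
weights `(2, 1)`. [OURS · L1 W4.5c · KILL-CRITERION v1 KC3∘KC4; NOT a statement of the manuscript] -/
theorem cobordantKillCert_smoothTransversalType (f : Fin 2 → B) (β x₄ h u : B) (hh : IsUnit h) (hu : IsUnit u)
    (hσJ : ∀ n : ℕ, ((weightedFiltration f ![2, 1]).ideal n).map (σ : B →+* B) ≤ (weightedFiltration f ![2, 1]).ideal n)
    (hadm : ∀ (n : ℕ) (y : B), y ∈ (weightedFiltration f ![2, 1]).ideal n →
      σ y - y ∈ Ideal.span {β} * (weightedFiltration f ![2, 1]).ideal (n + 1))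
    (hiso : ∃ N : ℕ, Ideal.span (Set.range f) ^ N ≤ (augmentationIdeal σ).colon (Ideal.span {β}))
    (h₃ : σ (f 1) - f 1 - β * h * f 0 ∈ Ideal.span {β} * (weightedFiltration f ![2, 1]).ideal 3)
    (h₄ : σ x₄ - x₄ - β * u * f 1 ∈ Ideal.span {β} * (weightedFiltration f ![2, 1]).ideal 2) :
    CobordantKillCert f ![2, 1] σ hσJ hp hσp
      (algebraMap B (↥(cobordantAlgebra f ![2, 1])) β * cobordantAlgebra.s f ![2, 1]) :=
  cobordantKillCert_of_admissible_of_irrelevant f ![2, 1] σ hσJ hp hσp β hadm hiso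
    ⟨1, by rw [pow_one]; exact irrelevant_of_smoothTransversalType σ hp hσp f β x₄ h u hh hu hσJ h₃ h₄⟩

end KC

end Summit.ResolutionOfSingularities.ResolutionOfSingularities.Theorems.WildQuotientResolution.S1.KillCert

end
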